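import Mathlib
import HarnessLib

/-!
# Smooth implicit function theorem with uniqueness on a product of balls

Topic `Literature/Analysis/Calculus` (namespace `Literature.Analysis.Calculus`). The quantitative
form of the implicit function theorem used to parametrise local zero sets of smooth nonlinear
(Fredholm-type) equations on Banach spaces: for `G : X × Y → Z` (`X, Y, Z` real Banach spaces) of
class `C^∞` with `G (x₀, y₀) = 0` and partial derivative `D₂G(x₀, y₀) = L : Y ≃L[ℝ] Z` a linear
homeomorphism, there are radii `ε, δ > 0` and a map `γ : X → Y`, `C^∞` on the ball `B(x₀, ε)`,
with `γ x₀ = y₀`, `γ(B(x₀, ε)) ⊆ B(y₀, δ)`, `G (x, γ x) = 0` on `B(x₀, ε)`, and UNIQUENESS of the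
zeros of `G` in the product of balls: `x ∈ B(x₀, ε)`, `y ∈ B(y₀, δ)`, `G (x, y) = 0` force
`y = γ x` (`exists_smooth_implicitFunction`).

Proof: the inverse function theorem (`HasStrictFDerivAt.toOpenPartialHomeomorph`) for
`Φ (x, y) = (x, G (x, y))`, whose derivative at `(x₀, y₀)` is the block-triangular isomorphism
`(ξ, η) ↦ (ξ, D₁G ξ + L η)`; `γ x = (Φ⁻¹ (x, 0)).2`. Smoothness of `γ` on a whole ball (not only
the `C^∞` germ at `x₀`, which for `n = ∞` does not propagate to a neighbourhood) uses
`OpenPartialHomeomorph.contDiffAt_symm` at every point of a neighbourhood of `(x₀, 0)` on whose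
preimage `DΦ` stays invertible (invertible operators form an open set,
`ContinuousLinearEquiv.nhds`). Mathlib has the germ statements only
(`ContDiffAt.implicitFunction`, `ContDiffAt.contDiffAt_implicitFunction`,
`HasStrictFDerivAt.implicitFunctionOfProdDomain`); the tree has the germ block form
`exists_implicit_of_block_deriv` (`ProductImplicitFunction.lean`). Everything is proved.

## References

* J. Dieudonné, *Foundations of Modern Analysis*, Academic Press 1960, Ch. X §2,
  (10.2.1)–(10.2.3). [Dieudonne1960]
* S. Lang, *Real and Functional Analysis*, Ch. XIV §2 (implicit mapping theorem). [folklore]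
-/

noncomputable section

open Set Filter Metric
open scoped Topology ContDiff

namespace Literature.Analysis.Calculus

/-- **Smooth implicit function theorem with uniqueness.** Let `X, Y, Z` be real Banach spaces,
`G : X × Y → Z` of class `C^∞`, `G (x₀, y₀) = 0`, and assume the partial derivative of `G` in the
second variable at `(x₀, y₀)`, i.e. `DG(x₀, y₀) ∘ inr`, is a linear homeomorphism `L : Y ≃L[ℝ] Z`.
Then there are `ε > 0`, `δ > 0` and `γ : X → Y` with: `γ` is `C^∞` on `ball x₀ ε`, `γ x₀ = y₀`,
`γ x ∈ ball y₀ δ` and `G (x, γ x) = 0` for `x ∈ ball x₀ ε`, and every zero `(x, y)` of `G` with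
`x ∈ ball x₀ ε`, `y ∈ ball y₀ δ` satisfies `y = γ x`.
[cite: Dieudonne1960, Ch. X §2 (10.2.1)–(10.2.3)] -/
theorem exists_smooth_implicitFunction {X Y Z : Type*} [NormedAddCommGroup X] [NormedSpace ℝ X]
    [CompleteSpace X]
    [NormedAddCommGroup Y] [NormedSpace ℝ Y] [CompleteSpace Y]
    [NormedAddCommGroup Z] [NormedSpace ℝ Z] [CompleteSpace Z]
    (G : X × Y → Z) (hG : ContDiff ℝ ∞ G) (x₀ : X) (y₀ : Y) (h0 : G (x₀, y₀) = 0)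
    (L : Y ≃L[ℝ] Z)
    (hL : (fderiv ℝ G (x₀, y₀)).comp (ContinuousLinearMap.inr ℝ X Y) = (L : Y →L[ℝ] Z)) :
    ∃ ε > (0 : ℝ), ∃ δ > (0 : ℝ), ∃ γ : X → Y, ContDiffOn ℝ ∞ γ (Metric.ball x₀ ε) ∧ γ x₀ = y₀ ∧
      (∀ x ∈ Metric.ball x₀ ε, γ x ∈ Metric.ball y₀ δ) ∧
      (∀ x ∈ Metric.ball x₀ ε, G (x, γ x) = 0) ∧
      (∀ x ∈ Metric.ball x₀ ε, ∀ y ∈ Metric.ball y₀ δ, G (x, y) = 0 → y = γ x) := by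
  have htop : (∞ : WithTop ℕ∞) ≠ 0 := by simp
  -- the derivative of `G` at the base point and its first partial derivative
  set f' : X × Y →L[ℝ] Z := fderiv ℝ G (x₀, y₀) with hf'
  set D₁ : X →L[ℝ] Z := f'.comp (ContinuousLinearMap.inl ℝ X Y) with hD₁
  have hf'_apply : ∀ q : X × Y, f' q = D₁ q.1 + L q.2 := fun q ↦ by
    have h := f'.comp_inl_add_comp_inr q
    rw [hL] at h
    exact h.symm
  -- `Φ (x, y) = (x, G (x, y))`, its derivative `Φ'` at `(x₀, y₀)` and the inverse `M` of `Φ'`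
  set Φ : X × Y → X × Z := fun q ↦ (q.1, G q) with hΦ
  set Φ' : X × Y →L[ℝ] X × Z := (ContinuousLinearMap.fst ℝ X Y).prod f' with hΦ'
  set M : X × Z →L[ℝ] X × Y := (ContinuousLinearMap.fst ℝ X Z).prod
    ((L.symm : Z →L[ℝ] Y).comp
      (ContinuousLinearMap.snd ℝ X Z - D₁.comp (ContinuousLinearMap.fst ℝ X Z))) with hM
  have hΦ'_apply : ∀ q : X × Y, Φ' q = (q.1, D₁ q.1 + L q.2) := fun q ↦ by
    simp [hΦ', hf'_apply]
  have hM_apply : ∀ q : X × Z, M q = (q.1, L.symm (q.2 - D₁ q.1)) := fun q ↦ by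
    simp [hM]
  have hleft : Function.LeftInverse M Φ' := fun q ↦ by
    rw [hΦ'_apply, hM_apply]
    ext <;> simp
  have hright : Function.RightInverse M Φ' := fun q ↦ by
    rw [hM_apply, hΦ'_apply]
    ext <;> simp
  set N : (X × Y) ≃L[ℝ] (X × Z) := ContinuousLinearEquiv.equivOfInverse Φ' M hleft hright with hN
  -- smoothness and strict differentiability of `Φ`
  have hΦc : ContDiff ℝ ∞ Φ := contDiff_fst.prodMk hG
  have hGd : HasStrictFDerivAt G f' (x₀, y₀) := hG.contDiffAt.hasStrictFDerivAt htop
  have hΦs : HasStrictFDerivAt Φ (N : X × Y →L[ℝ] X × Z) (x₀, y₀) := by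
    have h : HasStrictFDerivAt Φ Φ' (x₀, y₀) := hasStrictFDerivAt_fst.prodMk hGd
    exact h
  -- the local inverse
  set e : OpenPartialHomeomorph (X × Y) (X × Z) := hΦs.toOpenPartialHomeomorph Φ with he
  have he_coe : (e : X × Y → X × Z) = Φ := rfl
  have hp₀e : ((x₀, y₀) : X × Y) ∈ e.source := hΦs.mem_toOpenPartialHomeomorph_source
  have hΦp₀ : Φ (x₀, y₀) = (x₀, 0) := by simp [hΦ, h0]
  have hx₀e : ((x₀, (0 : Z)) : X × Z) ∈ e.target := by
    rw [← hΦp₀]; exact hΦs.image_mem_toOpenPartialHomeomorph_target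
  have hsymm₀ : e.symm (x₀, 0) = (x₀, y₀) := by
    rw [← hΦp₀, ← he_coe]; exact e.left_inv hp₀e
  -- `DΦ` is invertible on a neighbourhood `V` of `(x₀, y₀)`
  set V : Set (X × Y) :=
    {q | fderiv ℝ Φ q ∈ range ((↑) : ((X × Y) ≃L[ℝ] (X × Z)) → X × Y →L[ℝ] X × Z)} with hV
  have hVn : V ∈ 𝓝 (x₀, y₀) := by
    have hcont : Continuous (fderiv ℝ Φ) := hΦc.continuous_fderiv htop
    have hfd : fderiv ℝ Φ (x₀, y₀) = (N : X × Y →L[ℝ] X × Z) := hΦs.hasFDerivAt.fderiv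
    have hnhds := N.nhds
    rw [← hfd] at hnhds
    exact hcont.continuousAt.preimage_mem_nhds hnhds
  obtain ⟨δ, hδ, hballδ⟩ : ∃ δ > 0, ball (x₀, y₀) δ ⊆ e.source ∩ V :=
    Metric.mem_nhds_iff.1 (Filter.inter_mem (e.open_source.mem_nhds hp₀e) hVn)
  -- the open set `W ∋ (x₀, 0)` of points of the target whose preimage lies in `ball (x₀, y₀) δ`
  set W : Set (X × Z) := e.target ∩ e.symm ⁻¹' ball (x₀, y₀) δ with hW
  have hWo : IsOpen W := e.isOpen_inter_preimage_symm isOpen_ball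
  have hx₀W : ((x₀, (0 : Z)) : X × Z) ∈ W := by
    refine ⟨hx₀e, ?_⟩
    rw [mem_preimage, hsymm₀]
    exact mem_ball_self hδ
  have hι : Continuous fun x : X ↦ ((x, (0 : Z)) : X × Z) := continuous_id.prodMk continuous_const
  obtain ⟨ε₁, hε₁, hballε₁⟩ : ∃ ε₁ > 0, ball x₀ ε₁ ⊆ (fun x : X ↦ ((x, (0 : Z)) : X × Z)) ⁻¹' W :=
    Metric.mem_nhds_iff.1 ((hWo.preimage hι).mem_nhds hx₀W)
  -- the implicit function
  set γ : X → Y := fun x ↦ (e.symm (x, 0)).2 with hγ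
  have hWx : ∀ x ∈ ball x₀ (min ε₁ δ), ((x, (0 : Z)) : X × Z) ∈ W := fun x hx ↦
    hballε₁ (ball_subset_ball (min_le_left _ _) hx)
  -- for `(x, 0) ∈ W`: `e.symm (x, 0) = (x, γ x)` and `G (x, γ x) = 0`
  have hpair : ∀ x : X, ((x, (0 : Z)) : X × Z) ∈ W → e.symm (x, 0) = (x, γ x) ∧ G (x, γ x) = 0 := by
    intro x hx
    have hr : Φ (e.symm (x, 0)) = (x, 0) := by rw [← he_coe]; exact e.right_inv hx.1
    have h1 : (e.symm (x, 0)).1 = x := by simpa [hΦ] using congrArg Prod.fst hr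
    have h2 : G (e.symm (x, 0)) = 0 := by simpa [hΦ] using congrArg Prod.snd hr
    have hq : e.symm (x, 0) = (x, γ x) := Prod.ext h1 rfl
    exact ⟨hq, by rw [← hq]; exact h2⟩
  refine ⟨min ε₁ δ, lt_min hε₁ hδ, δ, hδ, γ, ?_, ?_, ?_, ?_, ?_⟩
  · -- smoothness on the ball
    intro x hx
    have hxW := hWx x hx
    have hqV : e.symm (x, 0) ∈ V := (hballδ hxW.2).2
    obtain ⟨N', hN'⟩ := hqV
    have hderiv : HasFDerivAt e (N' : X × Y →L[ℝ] X × Z) (e.symm (x, 0)) := by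
      rw [hN', he_coe]
      exact ((hΦc.differentiable htop) _).hasFDerivAt
    have hsymm : ContDiffAt ℝ ∞ e.symm (x, 0) := e.contDiffAt_symm hxW.1 hderiv hΦc.contDiffAt
    have hcomp : ContDiffAt ℝ ∞ (fun x : X ↦ (e.symm (x, 0)).2) x :=
      contDiffAt_snd.comp x (hsymm.comp x (contDiffAt_id.prodMk contDiffAt_const))
    exact hcomp.contDiffWithinAt
  · -- value at `x₀`
    simp only [hγ]
    rw [hsymm₀]
  · -- values in `ball y₀ δ`
    intro x hx
    have hxW := hWx x hx
    have hq : e.symm (x, 0) ∈ ball (x₀, y₀) δ := hxW.2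
    rw [mem_ball, Prod.dist_eq] at hq
    exact mem_ball.2 (lt_of_le_of_lt (le_max_right _ _) hq)
  · -- zeros
    intro x hx
    exact (hpair x (hWx x hx)).2
  · -- uniqueness
    intro x hx y hy hxy
    have hxyb : ((x, y) : X × Y) ∈ ball (x₀, y₀) δ := by
      rw [mem_ball, Prod.dist_eq, max_lt_iff]
      exact ⟨(mem_ball.1 hx).trans_le (min_le_right _ _), mem_ball.1 hy⟩
    have hsrc : ((x, y) : X × Y) ∈ e.source := (hballδ hxyb).1
    have hl : e.symm (Φ (x, y)) = (x, y) := by rw [← he_coe]; exact e.left_inv hsrc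
    have hΦxy : Φ (x, y) = (x, 0) := by simp [hΦ, hxy]
    rw [hΦxy] at hl
    simp only [hγ]
    rw [hl]

end Literature.Analysis.Calculus

end
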